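/-
Copyright (c) 2026. All rights reserved.
Released under Apache 2.0 license as described in the file LICENSE.
-/
import Summits.Langlands.Langlands.Theorems.SoloInformedRepairD2CrisGLOne
import Literature.NumberTheory.PAdicHodge.UnramifiedWittVectors
import Literature.NumberTheory.PAdicHodge.BmaxPlusXiRootsNonvanishing
import Literature.NumberTheory.GaloisRepresentations.LocalGaloisGroupFrobeniusProofs
import HarnessLib

/-!
# Teichmüller periods: `K₀ = W(k_F)[1/p]` inside the constructed `B_max(F)`

Solo/informed seat, statement repair D2-cris (`SoloInformedRepairD2Cris`): the clause
`CrystallineCompatibleAt` asks for a `ℚ̄_ℓ`-basis of `D_cris(ρ|Γ_{K_v})` of size `n · f(v|ℓ)`.  The factor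
`n` was certified on `GL_1` (`SoloInformedRepairD2CrisGLOne`: `e ⊗ t⁻¹ ∈ D_cris(χ_cyc)`); this file
certifies the RESIDUE-DEGREE factor `f`: the maximal unramified subfield `K₀ = F₀ = W(k_F)[1/p]` of `F`
sits `Γ_F`-invariantly inside the constructed ring `B_max(F) = A_max[1/t]`, with its Frobenius.

For `a ∈ 𝒪_F` let `ā ∈ k̄` be its residue in the residue field of `𝒪̂_{F^nr}` and
`u_a := [ā] ∈ W(k̄) → 𝔸_inf(F) → A_max → B_max(F)` its Teichmüller period (`teichBmax a`).  Then

* `galBmax_teichBmax`: `σ u_a = u_a` for every `σ ∈ Γ_F` (`Γ_F` fixes `𝒪_F`, hence `ā`);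
* `frobBmax_teichBmax`: `φ u_a = u_a ^ p`, and `teichBmax_pow_residueFieldCard`: `u_a ^ q_F = u_a`
  (an arithmetic Frobenius acts as `x ↦ x^q` on `k̄` and trivially on `k_F`), so `φ^{f} u_a = u_a` when
  `q_F = p^f` (`frobBmax_iterate_teichBmax_eq_self`);
* `linearIndependent_teichBmax`: if the residues `ā₁, …, ā_f` are `𝔽_p`-linearly independent then
  `u_{a_1}, …, u_{a_f}` are `ℚ_p`-linearly independent in `B_max(F)` — given Fontaine's `θ` surjective
  (the tree's standing hypothesis making `𝔸_inf → A_max → A_max[1/t]` injective); proof by `p`-adic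
  descent: a `ℤ_p`-relation reduces, via the constant Witt coefficient `𝔸_inf → 𝒪_{ℂ_F}♭ ⊇ k̄`, to an
  `𝔽_p`-relation among the `ā_j`, so all coefficients are divisible by `p`, and `p` is a unit of `B_max`;
* `exists_residue_independent`: such `a₁, …, a_f ∈ 𝒪_F` exist when `q_F = p ^ f`
  (`[k_F : 𝔽_p] = f`); `exists_teichmuller_periods` packages the four facts.

Consequence (file `SoloInformedRepairD2CrisResidueDegree`): `D_cris` of the trivial rank-`m`
representation contains `m·f` independent `φ^f`-fixed vectors `e_i ⊗ u_{a_j}`, matching the clause's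
`finrank = n·f`, `charpoly φ^f = (∏ (X - α))^f` at `α = {1,…,1}`.  What is NOT proved here (needs
`B_max^{Γ_F} = F₀`, not in the tree): the reverse inequality `finrank ≤ m·f`.

References: Fontaine, *Le corps des périodes p-adiques*, Astérisque 223 (1994), Exp. II §1.2, §2.3;
Colmez, Ann. of Math. 148 (1998), §III.2; Serre, *Local Fields*, Ch. II §4–§5.
-/

noncomputable section

open scoped MatrixGroups TensorProduct Valued
open Field WittVector IsLocalRing ValuativeRel
open Literature.NumberTheory.GaloisRepresentations Literature.NumberTheory.PAdicHodge
open Literature.NumberTheory.GaloisRepresentations.IsNonarchimedeanLocalField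

namespace Summit.Langlands.Langlands.Theorems

namespace D2Cris

/-! ### §1 Residues of `𝒪_F` in `k̄` -/

section Residue

variable {F : Type} [Field F] [ValuativeRel F] [TopologicalSpace F] [IsNonarchimedeanLocalField F]

variable (F) in
/-- **`a ↦ ā`**: the residue of `a ∈ 𝒪_F` in the residue field `k̄` of `𝒪̂_{F^nr}`.
[cite: SerreLocalFields1979, Ch. II §4] -/
def resBar : 𝒪[F] →+* ResidueField (maxUnramifiedCompletion F) :=
  (IsLocalRing.residue (maxUnramifiedCompletion F)).comp (algebraMap 𝒪[F] (maxUnramifiedCompletion F))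

/-- Unfolding of `resBar`. [folklore] -/
theorem resBar_apply (a : 𝒪[F]) :
    resBar F a = IsLocalRing.residue _ (algebraMap 𝒪[F] (maxUnramifiedCompletion F) a) := rfl

/-- **`Γ_F` fixes `k_F ⊆ k̄`**: `σ̄ ā = ā`. [cite: SerreLocalFields1979, Ch. II §4] -/
theorem residueGal_resBar (σ : absoluteGaloisGroup F) (a : 𝒪[F]) :
    residueGal σ (resBar F a) = resBar F a := by
  rw [resBar_apply, residueGal_residue, maxUnramifiedCompletion.galAut_algebraMap]

/-- `ā = 0 ↔ a ∈ 𝔪_F` (`𝒪_F → 𝒪̂_{F^nr}` is faithful on the maximal ideals). [folklore] -/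
theorem resBar_eq_zero_iff (a : 𝒪[F]) : resBar F a = 0 ↔ a ∈ 𝓂[F] := by
  have h1 := maxUnramifiedCompletion.algebraMap_mem_maximalIdeal_pow_iff (F := F) 1 a
  simp only [pow_one] at h1
  rw [resBar_apply, IsLocalRing.residue_eq_zero_iff, h1]

/-- **`ā ^ q_F = ā`** (`k_F = 𝔽_q`): an arithmetic Frobenius `σ` acts on `𝒪̂_{F^nr}` as `x ↦ x ^ q`
modulo `𝔪̂` and fixes `𝒪_F`. [cite: SerreLocalFields1979, Ch. II §4] -/
theorem resBar_pow_residueFieldCard (a : 𝒪[F]) : resBar F a ^ residueFieldCard F = resBar F a := by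
  obtain ⟨σ, hσ⟩ := exists_isAbsArithFrob_holds F
  have h := IsAbsArithFrob.galAut_sub_pow_mem_maximalIdeal hσ (algebraMap 𝒪[F] (maxUnramifiedCompletion F) a)
  rw [maxUnramifiedCompletion.galAut_algebraMap] at h
  rw [resBar_apply, ← map_pow]
  exact ((Ideal.Quotient.mk_eq_mk_iff_sub_mem _ _).2 h).symm

/-- `p ∈ 𝔪_F` when `p` is not a unit of `𝒪̂_{F^nr}` (the residue characteristic is `p`). [folklore] -/
theorem natCast_mem_maximalIdeal (p : ℕ) [Fact (¬ IsUnit (p : maxUnramifiedCompletion F))] :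
    (p : 𝒪[F]) ∈ 𝓂[F] := by
  have h : (p : maxUnramifiedCompletion F) ∈ maximalIdeal (maxUnramifiedCompletion F) :=
    (IsLocalRing.mem_maximalIdeal _).2 (mem_nonunits_iff.2 Fact.out)
  have h1 := maxUnramifiedCompletion.algebraMap_mem_maximalIdeal_pow_iff (F := F) 1 (p : 𝒪[F])
  simp only [pow_one, map_natCast] at h1
  exact h1.1 h

/-- The residue field `k_F` has characteristic `p`. [folklore] -/
theorem charP_residueField_integer (p : ℕ) [Fact p.Prime] [Fact (¬ IsUnit (p : maxUnramifiedCompletion F))] :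
    CharP 𝓀[F] p :=
  (CharP.charP_iff_prime_eq_zero Fact.out).2 <| by
    rw [← map_natCast (IsLocalRing.residue 𝒪[F]), IsLocalRing.residue_eq_zero_iff]
    exact natCast_mem_maximalIdeal p

/-- **A lift of an `𝔽_p`-basis of `k_F`**: if `q_F = p ^ f` there are `a₁, …, a_f ∈ 𝒪_F` whose residues are
`𝔽_p`-linearly independent — stated with natural-number coefficients: `∑ n_j a_j ∈ 𝔪_F ⇒ p ∣ n_j`.
[cite: SerreLocalFields1979, Ch. II §4] -/
theorem exists_residue_independent (p : ℕ) [Fact p.Prime] [Fact (¬ IsUnit (p : maxUnramifiedCompletion F))]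
    {f : ℕ} (hq : residueFieldCard F = p ^ f) :
    ∃ a : Fin f → 𝒪[F], ∀ n : Fin f → ℕ, (∑ j, (n j : 𝒪[F]) * a j) ∈ 𝓂[F] → ∀ j, p ∣ n j := by
  classical
  haveI : CharP 𝓀[F] p := charP_residueField_integer p
  letI : Algebra (ZMod p) 𝓀[F] := ZMod.algebra _ p
  haveI : Fintype 𝓀[F] := Fintype.ofFinite _
  have hcard : Fintype.card 𝓀[F] = p ^ Module.finrank (ZMod p) 𝓀[F] := by
    rw [Module.card_eq_pow_finrank (K := ZMod p), ZMod.card]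
  have hf : Module.finrank (ZMod p) 𝓀[F] = f := by
    apply Nat.pow_right_injective (Fact.out : p.Prime).two_le
    show p ^ _ = p ^ f
    rw [← hcard, ← hq, residueFieldCard, Nat.card_eq_fintype_card]
  let b := Module.finBasisOfFinrankEq (ZMod p) 𝓀[F] hf
  choose a ha using fun j =>
    (show Function.Surjective (IsLocalRing.residue 𝒪[F]) from Ideal.Quotient.mk_surjective) (b j)
  refine ⟨a, fun n hn j => ?_⟩
  have h0 : IsLocalRing.residue 𝒪[F] (∑ j, (n j : 𝒪[F]) * a j) = 0 :=
    (IsLocalRing.residue_eq_zero_iff _).2 hn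
  have h1 : ∑ j, (n j : ZMod p) • b j = 0 := by
    rw [← h0, map_sum]
    refine Finset.sum_congr rfl fun j _ => ?_
    rw [map_mul, map_natCast, ha j, Algebra.smul_def, map_natCast]
  have h2 := Fintype.linearIndependent_iff.1 b.linearIndependent (fun j => (n j : ZMod p)) h1 j
  exact (CharP.cast_eq_zero_iff (ZMod p) p (n j)).1 h2

end Residue

/-! ### §2 Teichmüller periods in `𝔸_inf(F)` -/

section Ainf

variable {F : Type} [Field F] [ValuativeRel F] [TopologicalSpace F] [IsNonarchimedeanLocalField F]
  [CharZero F] {p : ℕ} [Fact p.Prime] [Fact (¬ IsUnit (p : maxUnramifiedCompletion F))]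
  [CharP (ResidueField (maxUnramifiedCompletion F)) p] [Fact (¬ IsUnit (p : integerC F))]

/-- **`[ā] ∈ 𝔸_inf(F)`**: the Teichmüller representative of `ā ∈ k̄ ⊆ 𝒪_{ℂ_F}♭`, i.e. the image of
`[ā] ∈ W(k̄)` under `W(k̄) → 𝔸_inf(F)`. [cite: FontaineAsterisque223III, Exp. II §1.2] -/
def teichAinf (a : 𝒪[F]) : Ainf (p := p) F := wittToAinf F p (teichmuller p (resBar F a))

/-- `Γ_F` fixes `[ā]`. [cite: FontaineAsterisque223III, Exp. II §1.2] -/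
theorem galAinf_teichAinf (σ : absoluteGaloisGroup F) (a : 𝒪[F]) :
    galAinf σ (teichAinf (p := p) a) = teichAinf a := by
  rw [teichAinf, galAinf_wittToAinf, WittVector.map_teichmuller, residueGal_resBar]

/-- **`φ [ā] = [ā] ^ p`** (Witt-vector Frobenius on Teichmüller representatives). [folklore] -/
theorem frobenius_teichAinf (a : 𝒪[F]) :
    WittVector.frobenius (teichAinf (p := p) a) = teichAinf a ^ p := by
  rw [teichAinf, wittToAinf_teichmuller, WittVector.frobenius_eq_map_frobenius, WittVector.map_teichmuller,
    frobenius_def, map_pow]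

/-- **`[ā] ^ q_F = [ā]`.** [folklore] -/
theorem teichAinf_pow_residueFieldCard (a : 𝒪[F]) :
    teichAinf (p := p) a ^ residueFieldCard F = teichAinf a := by
  rw [teichAinf, ← map_pow, ← map_pow, resBar_pow_residueFieldCard]

/-- The constant Witt coefficient of `[ā]` is `ā ∈ k̄ ↪ 𝒪_{ℂ_F}♭`. [folklore] -/
theorem coeff_zero_teichAinf (a : 𝒪[F]) :
    (teichAinf (p := p) a).coeff 0 = tiltMap p (toCInt₀ F) (residueTiltEquiv F p (resBar F a)) := by
  rw [teichAinf, wittToAinf_teichmuller, WittVector.teichmuller_coeff_zero]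

/-- `k̄ → (𝒪̂_{F^nr})♭ → 𝒪_{ℂ_F}♭` is injective (a ring map out of a field). [folklore] -/
theorem tiltMap_residueTiltEquiv_injective :
    Function.Injective ((tiltMap p (toCInt₀ F)).comp (residueTiltEquiv F p).toRingHom) := by
  haveI : Nontrivial (PreTilt (integerC F) p) :=
    CharP.nontrivial_of_char_ne_one (R := PreTilt (integerC F) p) (Fact.out : p.Prime).ne_one
  exact RingHom.injective _

end Ainf

/-! ### §3 Teichmüller periods in `B_max(F)`: `Γ_F`-invariance and Frobenius -/

variable {F : Type} [Field F] [ValuativeRel F] [TopologicalSpace F] [IsNonarchimedeanLocalField F]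
  [CharZero F] {p : ℕ} [Fact p.Prime] [Fact (¬ IsUnit (p : maxUnramifiedCompletion F))]
  [CharP (ResidueField (maxUnramifiedCompletion F)) p] [Fact (¬ IsUnit (p : integerC F))]
  [IsAdicComplete (Ideal.span {(p : integerC F)}) (integerC F)]

variable (F p) in
/-- `𝔸_inf(F) → A_max → B_max(F) = A_max[1/t]`. [folklore] -/
def ainfToBmax : Ainf (p := p) F →+* Bmax F p := (algebraMap (BmaxPlus F p) (Bmax F p)).comp (ainfToBmaxPlus F p)

omit [Fact (¬ IsUnit (p : maxUnramifiedCompletion F))] [CharP (ResidueField (maxUnramifiedCompletion F)) p] in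
/-- `ℤ_p → B_max(F)` factors through `𝔸_inf(F) → B_max(F)`. [folklore] -/
theorem ainfToBmax_zpToAinf (d : ℤ_[p]) : ainfToBmax F p (zpToAinf d) = zpToBmax F p d := rfl

omit [Fact (¬ IsUnit (p : maxUnramifiedCompletion F))] [CharP (ResidueField (maxUnramifiedCompletion F)) p] in
/-- **`𝔸_inf(F) → B_max(F)` is injective** once `θ` is surjective (`𝔸_inf → A_max` injective; `t` is a
non-zero-divisor of `A_max`). [cite: Colmez1998Annals, §III.2] -/
theorem ainfToBmax_injective (hF : Function.Surjective (fontaineTheta (integerC F) p)) :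
    Function.Injective (ainfToBmax F p) := by
  have ht : tBmax (F := F) (p := p) ∈ nonZeroDivisors (BmaxPlus F p) :=
    mem_nonZeroDivisors_iff.2 ⟨fun z hz => eq_zero_of_tBmax_mul_eq_zero hF hz,
      fun z hz => eq_zero_of_tBmax_mul_eq_zero hF (by rwa [mul_comm] at hz)⟩
  exact (IsLocalization.injective (M := Submonoid.powers (tBmax (F := F) (p := p))) (Bmax F p)
    ((Submonoid.powers_le).2 ht)).comp (ainfToBmaxPlus_injective hF)

/-- **The Teichmüller period `u_a := [ā] ∈ B_max(F)`** of `a ∈ 𝒪_F`. [cite: FontaineAsterisque223III, Exp. II §2.3] -/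
def teichBmax (a : 𝒪[F]) : Bmax F p := ainfToBmax F p (teichAinf a)

/-- Unfolding of `teichBmax`. [folklore] -/
theorem ainfToBmax_teichAinf (a : 𝒪[F]) : ainfToBmax F p (teichAinf a) = teichBmax a := rfl

/-- **`σ u_a = u_a` for all `σ ∈ Γ_F`**: the Teichmüller periods are `Γ_F`-invariant elements of the
constructed `B_max(F)` (they span `W(k_F)[1/p] = F₀ ⊆ B_max^{Γ_F}`). [cite: FontaineAsterisque223III, Exp. II §2.3] -/
theorem galBmax_teichBmax (σ : absoluteGaloisGroup F) (a : 𝒪[F]) :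
    galBmax σ (teichBmax (p := p) a) = teichBmax a := by
  rw [← ainfToBmax_teichAinf, ainfToBmax, RingHom.comp_apply, galBmax_algebraMap,
    galBmaxPlus_ainfToBmaxPlus, galAinf_teichAinf]

/-- **`φ u_a = u_a ^ p`.** [cite: FontaineAsterisque223III, Exp. II §2.3] -/
theorem frobBmax_teichBmax (a : 𝒪[F]) : frobBmax F p (teichBmax a) = teichBmax a ^ p := by
  rw [← ainfToBmax_teichAinf, ainfToBmax, RingHom.comp_apply, frobBmax_algebraMap,
    frobBmaxPlus_ainfToBmaxPlus, frobenius_teichAinf, map_pow, map_pow]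

/-- **`u_a ^ q_F = u_a`.** [folklore] -/
theorem teichBmax_pow_residueFieldCard (a : 𝒪[F]) :
    teichBmax (p := p) a ^ residueFieldCard F = teichBmax a := by
  rw [← ainfToBmax_teichAinf, ← map_pow, teichAinf_pow_residueFieldCard]

/-- `φ^k u_a = u_a ^ (p ^ k)`. [folklore] -/
theorem frobBmax_iterate_teichBmax (k : ℕ) (a : 𝒪[F]) :
    (frobBmax F p)^[k] (teichBmax a) = teichBmax a ^ p ^ k := by
  induction k with
  | zero => simp
  | succ k ih => rw [Function.iterate_succ_apply', ih, map_pow, frobBmax_teichBmax, ← pow_mul, ← pow_succ']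

/-- **`φ^f u_a = u_a` when `q_F = p ^ f`**: on `K₀ ⊆ B_max(F)` the `f`-th power of Frobenius is the
identity (`φ_{D_cris}^f` is `K₀`-linear). [cite: FontaineAsterisque223VIII, §2.3.7] -/
theorem frobBmax_iterate_teichBmax_eq_self {f : ℕ} (hq : residueFieldCard F = p ^ f) (a : 𝒪[F]) :
    (frobBmax F p)^[f] (teichBmax a) = teichBmax a := by
  rw [frobBmax_iterate_teichBmax, ← hq, teichBmax_pow_residueFieldCard]

/-! ### §4 `ℚ_p`-linear independence by `p`-adic descent -/

/-- **Base step**: a `ℤ_p`-relation `∑ d_j u_{a_j} = 0` in `B_max(F)` among Teichmüller periods with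
`𝔽_p`-independent residues has all coefficients divisible by `p` — pull back to `𝔸_inf` (injectivity,
`θ` surjective), take the constant Witt coefficient in `𝒪_{ℂ_F}♭ ⊇ k̄`, where `d_j ≡ (d_j mod p)` and
`[ā_j] ↦ ā_j`. [folklore] -/
theorem dvd_of_sum_zpToBmax_mul_teichBmax_eq_zero (hF : Function.Surjective (fontaineTheta (integerC F) p))
    {f : ℕ} {a : Fin f → 𝒪[F]} (ha : ∀ n : Fin f → ℕ, (∑ j, (n j : 𝒪[F]) * a j) ∈ 𝓂[F] → ∀ j, p ∣ n j)
    {d : Fin f → ℤ_[p]} (hd : ∑ j, zpToBmax F p (d j) * teichBmax (a j) = 0) (j : Fin f) :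
    (p : ℤ_[p]) ∣ d j := by
  set ψ := (tiltMap p (toCInt₀ F)).comp (residueTiltEquiv F p).toRingHom
  -- `d_j = n_j + p b_j` with `n_j ∈ ℕ`
  have hb : ∀ j, ∃ b : ℤ_[p], d j = ((PadicInt.toZModPow 1 (d j)).val : ℤ_[p]) + (p : ℤ_[p]) * b :=
    fun j => by simpa only [pow_one] using exists_eq_natCast_add_pow_mul (d j) 1
  choose b hb using hb
  -- (1) the relation already holds in `𝔸_inf(F)`
  have hA : ∑ j, zpToAinf (d j) * teichAinf (p := p) (a j) = 0 := by
    apply ainfToBmax_injective hF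
    rw [map_sum, map_zero, ← hd]
    exact Finset.sum_congr rfl fun j _ => by rw [map_mul, ainfToBmax_zpToAinf, ainfToBmax_teichAinf]
  -- (2) its constant Witt coefficient is an `𝔽_p`-relation among the `ā_j` inside `𝒪_{ℂ_F}♭`
  have hC : ψ (resBar F (∑ j, ((PadicInt.toZModPow 1 (d j)).val : 𝒪[F]) * a j)) = 0 := by
    have h := congrArg WittVector.constantCoeff hA
    rw [map_sum, map_zero] at h
    rw [map_sum, map_sum, ← h]
    refine Finset.sum_congr rfl fun j _ => ?_
    rw [map_mul, map_mul, map_natCast, map_natCast, map_mul]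
    conv_rhs => rw [hb j, map_add, map_mul, map_natCast, map_natCast, map_add, map_mul, map_natCast,
      map_natCast, CharP.cast_eq_zero (PreTilt (integerC F) p) p, zero_mul, add_zero, WittVector.constantCoeff_apply, coeff_zero_teichAinf]
    rfl
  -- (3) hence `∑ n_j a_j ∈ 𝔪_F`, so `p ∣ n_j`, so `p ∣ d_j`
  have hres : resBar F (∑ j, ((PadicInt.toZModPow 1 (d j)).val : 𝒪[F]) * a j) = 0 :=
    (injective_iff_map_eq_zero ψ).1 tiltMap_residueTiltEquiv_injective _ hC
  obtain ⟨c, hc⟩ := ha (fun j => (PadicInt.toZModPow 1 (d j)).val) ((resBar_eq_zero_iff _).1 hres) j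
  refine ⟨c + b j, ?_⟩
  rw [hb j, hc]
  push_cast
  ring

/-- **Descent**: every coefficient of such a relation is divisible by every power of `p` (`p` is a unit of
`B_max(F)`, so `∑ (d_j / p) u_{a_j} = 0` again). [folklore] -/
theorem pow_dvd_of_sum_zpToBmax_mul_teichBmax_eq_zero (hF : Function.Surjective (fontaineTheta (integerC F) p))
    {f : ℕ} {a : Fin f → 𝒪[F]} (ha : ∀ n : Fin f → ℕ, (∑ j, (n j : 𝒪[F]) * a j) ∈ 𝓂[F] → ∀ j, p ∣ n j)
    (N : ℕ) : ∀ d : Fin f → ℤ_[p], ∑ j, zpToBmax F p (d j) * teichBmax (a j) = 0 →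
      ∀ j, (p : ℤ_[p]) ^ N ∣ d j := by
  induction N with
  | zero => intro d _ j; simp
  | succ N ih =>
    intro d hd j
    choose d' hd' using fun j => dvd_of_sum_zpToBmax_mul_teichBmax_eq_zero hF ha hd j
    have hd'' : ∑ j, zpToBmax F p (d' j) * teichBmax (a j) = 0 := by
      have h2 : (p : Bmax F p) * ∑ j, zpToBmax F p (d' j) * teichBmax (a j) = 0 := by
        rw [Finset.mul_sum, ← hd]
        exact Finset.sum_congr rfl fun j _ => by rw [hd' j, map_mul, map_natCast, mul_assoc]
      exact (isUnit_natCast_bmax (F := F) (p := p)).mul_right_eq_zero.1 h2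
    obtain ⟨c, hc⟩ := ih d' hd'' j
    exact ⟨c, by rw [hd' j, hc, pow_succ', mul_assoc]⟩

omit [Fact p.Prime] in
/-- An element of `ℤ_p` divisible by every power of `p` is `0`. [folklore] -/
theorem padicInt_eq_zero_of_forall_pow_dvd [hp : Fact p.Prime] {d : ℤ_[p]} (h : ∀ N : ℕ, (p : ℤ_[p]) ^ N ∣ d) :
    d = 0 := by
  by_contra hd
  have hpos : 0 < ‖d‖ := norm_pos_iff.2 hd
  have hp1 : 1 < (p : ℝ) := by exact_mod_cast hp.out.one_lt
  obtain ⟨N, hN⟩ := exists_pow_lt_of_lt_one hpos (inv_lt_one_of_one_lt₀ hp1)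
  have hle : ‖d‖ ≤ (p : ℝ) ^ (-(N : ℤ)) :=
    (PadicInt.norm_le_pow_iff_mem_span_pow d N).2 (Ideal.mem_span_singleton.2 (h N))
  rw [zpow_neg, zpow_natCast, ← inv_pow] at hle
  exact lt_irrefl _ (hN.trans_le hle)

/-- **A `ℤ_p`-relation among Teichmüller periods with `𝔽_p`-independent residues is trivial.** [folklore] -/
theorem eq_zero_of_sum_zpToBmax_mul_teichBmax_eq_zero (hF : Function.Surjective (fontaineTheta (integerC F) p))
    {f : ℕ} {a : Fin f → 𝒪[F]} (ha : ∀ n : Fin f → ℕ, (∑ j, (n j : 𝒪[F]) * a j) ∈ 𝓂[F] → ∀ j, p ∣ n j)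
    {d : Fin f → ℤ_[p]} (hd : ∑ j, zpToBmax F p (d j) * teichBmax (a j) = 0) : d = 0 :=
  funext fun j => padicInt_eq_zero_of_forall_pow_dvd fun N =>
    pow_dvd_of_sum_zpToBmax_mul_teichBmax_eq_zero hF ha N d hd j

/-- **`ℚ_p`-linear independence of the Teichmüller periods** `u_{a_1}, …, u_{a_f} ∈ B_max(F)` when the
residues `ā_j` are `𝔽_p`-linearly independent (clear denominators, then the `ℤ_p` case): `f` independent
`Γ_F`-invariant periods — the residue-degree factor of `dim D_cris`. [cite: FontaineAsterisque223III, Exp. II §2.3] -/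
theorem linearIndependent_teichBmax (hF : Function.Surjective (fontaineTheta (integerC F) p))
    {f : ℕ} {a : Fin f → 𝒪[F]} (ha : ∀ n : Fin f → ℕ, (∑ j, (n j : 𝒪[F]) * a j) ∈ 𝓂[F] → ∀ j, p ∣ n j) :
    LinearIndependent ℚ_[p] (fun j => teichBmax (F := F) (p := p) (a j)) := by
  refine Fintype.linearIndependent_iff.2 fun c hc j => ?_
  -- clear denominators: `p ^ M c_j ∈ ℤ_p`
  obtain ⟨M, hM⟩ := exists_nat_ge (∑ j, ‖c j‖)
  have hpM : (0 : ℝ) < (p : ℝ) ^ M := pow_pos (by exact_mod_cast (Fact.out : p.Prime).pos) M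
  have hint : ∀ j, ‖(p : ℚ_[p]) ^ M * c j‖ ≤ 1 := fun j => by
    have hcj : ‖c j‖ ≤ (p : ℝ) ^ M :=
      ((Finset.single_le_sum (fun i _ => norm_nonneg (c i)) (Finset.mem_univ j)).trans hM).trans
        (by exact_mod_cast (Nat.lt_pow_self (Fact.out : p.Prime).one_lt).le)
    rw [norm_mul, Padic.norm_p_pow, zpow_neg, zpow_natCast]
    calc ((p : ℝ) ^ M)⁻¹ * ‖c j‖ ≤ ((p : ℝ) ^ M)⁻¹ * (p : ℝ) ^ M :=
          mul_le_mul_of_nonneg_left hcj (inv_nonneg.2 hpM.le)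
      _ = 1 := inv_mul_cancel₀ hpM.ne'
  let d : Fin f → ℤ_[p] := fun j => ⟨(p : ℚ_[p]) ^ M * c j, hint j⟩
  have hd : ∑ j, zpToBmax F p (d j) * teichBmax (a j) = 0 := by
    have h1 : ∑ j, zpToBmax F p (d j) * teichBmax (a j) =
        algebraMap ℚ_[p] (Bmax F p) ((p : ℚ_[p]) ^ M) * ∑ j, c j • teichBmax (a j) := by
      rw [Finset.mul_sum]
      exact Finset.sum_congr rfl fun j _ => by
        rw [zpToBmax_eq_algebraMap, Algebra.smul_def, ← mul_assoc, ← map_mul]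
    rw [h1, hc, mul_zero]
  have h0 := congr_fun (eq_zero_of_sum_zpToBmax_mul_teichBmax_eq_zero hF ha hd) j
  have h2 : (p : ℚ_[p]) ^ M * c j = 0 := by
    have := congrArg (fun x : ℤ_[p] => (x : ℚ_[p])) h0
    simpa [d] using this
  exact (mul_eq_zero.1 h2).resolve_left (pow_ne_zero _ (Nat.cast_ne_zero.2 (Fact.out : p.Prime).ne_zero))

/-! ### §5 Summary: `f = [k_F : 𝔽_p]` independent `Γ_F`-invariant periods with `φ^f = 1` -/

/-- **Teichmüller periods of `B_max(F)`**: if `q_F = p ^ f` and Fontaine's `θ` is surjective, the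
constructed `B_max(F)` contains `f` `ℚ_p`-linearly independent `Γ_F`-invariant elements `u_j` with
`φ u_j = u_j ^ p` and `φ^f u_j = u_j` (a `ℚ_p`-basis of `K₀ = W(k_F)[1/p] ⊆ B_max(F)^{Γ_F}`).  This is the
residue-degree factor `f` in the rank `n · f(v|ℓ)` of `CrystallineCompatibleAt`.
[cite: FontaineAsterisque223III, Exp. II §2.3] [cite: FontaineAsterisque223VIII, §2.3.7] -/
theorem exists_teichmuller_periods (hF : Function.Surjective (fontaineTheta (integerC F) p)) {f : ℕ}
    (hq : residueFieldCard F = p ^ f) :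
    ∃ u : Fin f → Bmax F p, LinearIndependent ℚ_[p] u ∧ (∀ σ : absoluteGaloisGroup F, ∀ j, galBmax σ (u j) = u j) ∧
      (∀ j, frobBmax F p (u j) = u j ^ p) ∧ ∀ j, (frobBmax F p)^[f] (u j) = u j := by
  obtain ⟨a, ha⟩ := exists_residue_independent (F := F) p hq
  exact ⟨fun j => teichBmax (a j), linearIndependent_teichBmax hF ha, fun σ j => galBmax_teichBmax σ (a j),
    fun j => frobBmax_teichBmax (a j), fun j => frobBmax_iterate_teichBmax_eq_self hq (a j)⟩


end D2Cris

end Summit.Langlands.Langlands.Theorems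

end
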